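import Summits.NavierStokesRegularity.NavierStokesRegularity.Theorems.CriticalCoherenceDoorDefs
import HarnessLib

/-!
# IntenseSetDoorsDefs — door family S34 «IntenseSetDoors» (three TYPE-FREE doors on the scale-critical
# intense set): texts of record + the kernel-checked compositions (plate P0)

Texts of record: nsreg-p1 g28 `r32/Sketch34.lean` sha16 c542dddc314f2f7c (ROUND-32 305d4d147ffd366e, PLATE-AID-34;
farm rc 0 / 0 warn / 0 sorry, bc7 13/13 CLEAN), landed VERBATIM — every declaration below is the sketch's, unchanged —
by LEAD S-door ns-s30-p1 g2 (plate map 14:2xZ), `--supports stmt-NavierStokesRegularity-0056 --as helper`. The open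
statements are `def … : Prop` texts (no proof placeholders); the plates V34 `ValueCutoffLowStretching`, L34
`LambPairingBound`, T34C `CriticalMassStretching`, G34 `ForcedPowerGronwallSlab`, A34-A/B/C and the three closers land
BY NAME against them in `Theorems/IntenseSetDoors*.lean`.

HONEST FRAME: three regularity CRITERIA (calm / aligned / light critical core ⇒ continuation), TYPE-II-INCLUSIVE; item
0056 `NoTypeII` is NOT assumed and NOT met; nothing here proves NS regularity.

## The sketch header (verbatim)

S34 «IntenseSetDoors» — texts of record (nsreg-p1 g28; ROUND-32, 2026-08-28)

Door family S34 (purposes (a)/(b): the fine structure is the geometry of `u` against `ω` ON THE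
SCALE-CRITICAL INTENSE SET; TYPE-FREE — no rate hypothesis anywhere). With `ω = curl u` and the
intense set `S_t := {x : (T − t)|ω(x,t)| > ε₀}`, `ε₀ < √3/4` universal (the set of door S33):

* S34-A «CriticalCalmDoor»: for every `ε₀ < √3/4` there is a UNIVERSAL `ε₁ > 0` such that
  `∫_{S_t} |u|³ ≤ (ε₁ν)³` for all late `t` ⇒ continuation past `T` (the velocity is `L³`-calm on the
  intense-vorticity core; `u` is completely free off `S_t`);
* S34-B «BeltramiCoreDoor» (constant-free): `∫_{S_t} |u × ω|² ≤ K (T − t)^{−c}` for all late `t`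
  with ANY `K` and ANY `c < 3/2` ⇒ continuation past `T` (the Lamb vector `u × ω` on the core may
  blow up at every rate strictly below the critical one `(T − t)^{−3/2}`: alignment of `u` and `ω`
  — Beltramisation of the core — is REWARDED. Near-Beltrami criteria in print: Beirão da Veiga 2012
  (global sup-sine small, stress-free), Farhat 2018 arXiv:1804.08238 Thm 1 (sup-sine × local
  enstrophy^{1/4} bounded on `{|ω| > M} ∩ B_{2r}`, FIXED level `M`, regular point), Chae 2010 JMFM
  (`u × ω` in `L^{3,∞}`); here: L²-RATE on the CRITICAL moving level, no sup of the sine, type-free);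
* S34-C «CriticalMassDoor»: there is an ABSOLUTE `ε₂ > 0` such that
  `‖ω(t)‖_{L^{3/2}(S_t)} ≤ ε₂ν` for all late `t` ⇒ continuation past `T`
  (small critical vorticity mass on the core).

ONE ENGINE (three fixed-time plates + one Grönwall plate; `SubcriticalEnstrophyContinuation` =
S33's P2, a TREE THEOREM since p637832, BY NAME): split the stretching `2∫⟪ω,(∇u)ω⟫` with the
VALUE cut-off `θ = 1 − radialCutoff L ((1+η)L) ∘ ω`, `L = ε₀/(T − t)`. LOW (`|ω| < (1+η)L`): Chae's
strain algebra `two_mul_inner_curl_fderiv_le_of_divergence_eq_zero` gives `(2/√3)(1+η)L ∫|∇u|²_F`,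
i.e. the coefficient `a/(T − t)`, `a = (2/√3)(1+η)ε₀ < 1/2` (plate V34). HIGH: the Lamb–transport
identity `(∇u)ω = curl(u × ω) + (∇ω)u` (`curl_cross_apply`), in which the transport term integrates
to ZERO against `θ(ω)ω` (`⟪θω,(∇ω)u⟫ = u·∇G(ω)`, `div u = 0`, `G(ω)` compactly supported), and the
curl moves onto `θω` (`|curl(θω)| ≤ (√2 + B_θ(1+η)/η)|∇ω|_F` — the level `L` CANCELS on the layer):
`|HIGH| ≤ C_η ‖∇ω‖₂ ‖u × ω‖_{L²(S_t)}` (plate L34; the Lamb-form pairing with the curl moved onto the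
cut vorticity is the device of Farhat 2018 arXiv:1804.08238 §2 (there: spatial cut-off `ψ²ω`, split at a
FIXED level `M`); new here: VALUE cut-off at the critical level, level-free constant). Then (A) Hölder `L³(S_t) × L⁶`
+ Sobolev `eLpNorm_six_le_eLpNorm_fderiv_two` absorbs HIGH into `ν∫|∇ω|²_F`; (B) Young turns HIGH
into the forcing `(C_η²K/4ν)(T − t)^{−c}`; (C) no integration by parts at all: Hölder
`L^{3/2}(S_t) × L⁶ × L⁶` + Sobolev twice (plate T34C). In all three cases the enstrophy obeys
`E' ≤ (a/(T − t))E + β(T − t)^{−c}` with `a < 1/2`, `c < a + 1` (plate G34) ⇒ `E ≤ K'(T − t)^{−a}`,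
a SUB-LERAY power ⇒ P2. Kernel-checked below: `door_of : P1 → P2 → door` for each door and the
plate compositions.

Lean frame = door S33 `CriticalCoherenceDoor` (tree P0 p636457) binder for binder, the coherence
hypothesis replaced by the intense-set integral hypothesis.
HONEST FRAME: three regularity CRITERIA (calm / aligned / light core ⇒ no blow-up); NS regularity /
0056 `NoTypeII` NOT claimed; every plate is print-routine mathematics not in print as stated (ROUND-32 §6).
-/

noncomputable section

open MeasureTheory Set Function Filter Metric Real InnerProductSpace
open _root_.Topology
open scoped ENNReal NNReal RealInnerProductSpace ContDiff
open Literature.Analysis.FluidPDE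
open Summit.NavierStokesRegularity.NavierStokesRegularity.Theorems.CriticalCoherenceDoor
  (SubcriticalEnstrophyContinuation)

set_option linter.dupNamespace false

namespace Summit.NavierStokesRegularity.NavierStokesRegularity.Theorems.IntenseSetDoors

-- nested operator types (second derivatives)
set_option maxSynthPendingDepth 3

/-! ## §1 Door S34-A «CriticalCalmDoor» -/

/-- support (definition): the CRITICAL CALM hypothesis on `[t₀, T)`: for every `t ∈ [t₀, T)`,
`∫_{S_t} |u(x,t)|³ dx ≤ (ε₁ν)³` on the intense set `S_t = {x : (T − t)|ω(x,t)| > ε₀}`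
(`L³` is scale-critical and `ν`-homogeneous: `‖u‖_{L³(S_t)} ≤ ε₁ν`). -/
def CriticalCalm (u : ℝ → (EuclideanSpace ℝ (Fin 3)) → (EuclideanSpace ℝ (Fin 3)))
    (ν T t₀ ε₀ ε₁ : ℝ) : Prop :=
  ∀ t ∈ Ico t₀ T,
    (∫⁻ x in {x | ε₀ < (T - t) * ‖curl (u t) x‖}, ‖u t x‖ₑ ^ 3) ≤ ENNReal.ofReal ((ε₁ * ν) ^ 3)

/-- door S34-A «CriticalCalmDoor» (regularity criterion; type-free). For every `0 < ε₀ < √3/4`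
there is `ε₁ > 0` (depending on `ε₀` only) such that: for `ν > 0`, `0 ≤ t₀ < T` and a classical
unforced Navier–Stokes solution `(u, p)` on `ℝ³ × [0, T)` with all `L²` Sobolev seminorms bounded on
every `[0, T'']`, `T'' < T` (the frame of `CriticalCoherenceDoor`), `CriticalCalm u ν T t₀ ε₀ ε₁`
implies that `u` continues in the Sobolev class past `T`. Sub-case `S_t = ∅` = the enstrophy floor
`(2/√3)ε₀ < 1/2` versus Leray's rate (known); the content is that an intense set on which the
velocity is `L³`-small costs nothing, whatever `u` does elsewhere. Print neighbours: small `L^{3,∞}`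
on whole parabolic CYLINDERS ⇒ regular point (Takahashi 1990, Kozono 1998, Chae–Lee arXiv:1606.08126
Thm 3 (i)); here the smallness is charged on the critical super-level set only. -/
def CriticalCalmDoor : Prop :=
  ∀ (ε₀ : ℝ), 0 < ε₀ → ε₀ < Real.sqrt 3 / 4 → ∃ ε₁ : ℝ, 0 < ε₁ ∧
    ∀ (ν T t₀ : ℝ), 0 < ν → 0 ≤ t₀ → t₀ < T →
    ∀ (u : ℝ → (EuclideanSpace ℝ (Fin 3)) → (EuclideanSpace ℝ (Fin 3)))
      (p : ℝ → (EuclideanSpace ℝ (Fin 3)) → ℝ),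
      IsClassicalNSSolutionOn (Ico 0 T) ν 0 u p →
      (∀ T'' < T, HasBoundedSobolevNormsOn (Icc 0 T'') u) →
      CriticalCalm u ν T t₀ ε₀ ε₁ →
      HasSobolevExtensionPast ν u T

/-- plate P1-A «CriticalCalmPowerBound» (M; the content of door A). Same quantifier prefix; the
Dirichlet integral grows at most like a SUB-LERAY power: `∫|∇u(t)|²_F ≤ K (T − t)^{−a}` on `[t₀, T)`
with `K ≥ 0`, `a < 1/2`. Print proof = V34 + L34 + Hölder/Sobolev + G34 (`β = 0`), see
`CriticalCalmPowerBoundAssembly`. -/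
def CriticalCalmPowerBound : Prop :=
  ∀ (ε₀ : ℝ), 0 < ε₀ → ε₀ < Real.sqrt 3 / 4 → ∃ ε₁ : ℝ, 0 < ε₁ ∧
    ∀ (ν T t₀ : ℝ), 0 < ν → 0 ≤ t₀ → t₀ < T →
    ∀ (u : ℝ → (EuclideanSpace ℝ (Fin 3)) → (EuclideanSpace ℝ (Fin 3)))
      (p : ℝ → (EuclideanSpace ℝ (Fin 3)) → ℝ),
      IsClassicalNSSolutionOn (Ico 0 T) ν 0 u p →
      (∀ T'' < T, HasBoundedSobolevNormsOn (Icc 0 T'') u) →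
      CriticalCalm u ν T t₀ ε₀ ε₁ →
      ∃ K a : ℝ, 0 ≤ K ∧ a < 1 / 2 ∧ ∀ t ∈ Ico t₀ T,
        (∫⁻ x, ENNReal.ofReal (frobeniusNormSq (fderiv ℝ (u t) x))) ≤
          ENNReal.ofReal (K * (T - t) ^ (-a))

/-- composition (kernel-checked): P1-A and S33's P2 give door A. -/
theorem criticalCalmDoor_of (h₁ : CriticalCalmPowerBound) (h₂ : SubcriticalEnstrophyContinuation) :
    CriticalCalmDoor := by
  intro ε₀ hε₀ hε₀'
  obtain ⟨ε₁, hε₁, h⟩ := h₁ ε₀ hε₀ hε₀'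
  refine ⟨ε₁, hε₁, ?_⟩
  intro ν T t₀ hν ht₀ ht₀T u p hsol hreg hcalm
  obtain ⟨K, a, -, ha, hF⟩ := h ν T t₀ hν ht₀ ht₀T u p hsol hreg hcalm
  exact h₂ ν T t₀ K a hν ht₀ ht₀T ha u p hsol hreg hF

/-! ## §2 Door S34-B «BeltramiCoreDoor» -/

/-- support (definition): SUB-CRITICAL LAMB GROWTH on `[t₀, T)` with constants `K, c`: for every
`t ∈ [t₀, T)`, `∫_{S_t} |u(x,t) × ω(x,t)|² dx ≤ K (T − t)^{−c}` on the intense set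
`S_t = {x : (T − t)|ω(x,t)| > ε₀}` (the critical rate is `c = 3/2`; `K ≤ 0` says `u ∥ ω` on `S_t`). -/
def SubcriticalLamb (u : ℝ → (EuclideanSpace ℝ (Fin 3)) → (EuclideanSpace ℝ (Fin 3)))
    (T t₀ ε₀ K c : ℝ) : Prop :=
  ∀ t ∈ Ico t₀ T,
    (∫⁻ x in {x | ε₀ < (T - t) * ‖curl (u t) x‖}, ‖cross (u t x) (curl (u t) x)‖ₑ ^ 2) ≤
      ENNReal.ofReal (K * (T - t) ^ (-c))

/-- door S34-B «BeltramiCoreDoor» (regularity criterion; type-free; no smallness constant). For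
`ν > 0`, `0 ≤ t₀ < T`, `0 < ε₀ < √3/4`, ANY real `K` and ANY `c < 3/2`, in the frame of
`CriticalCoherenceDoor`: `SubcriticalLamb u T t₀ ε₀ K c` implies that `u` continues in the Sobolev
class past `T`. (At the critical rate `c = 3/2` the engine returns Leray's rate with constant
`∝ K/ν`, so only a SMALL `K < κν^{5/2}` would conclude — not claimed here.) -/
def BeltramiCoreDoor : Prop :=
  ∀ (ν T t₀ ε₀ K c : ℝ), 0 < ν → 0 ≤ t₀ → t₀ < T → 0 < ε₀ → ε₀ < Real.sqrt 3 / 4 → c < 3 / 2 →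
    ∀ (u : ℝ → (EuclideanSpace ℝ (Fin 3)) → (EuclideanSpace ℝ (Fin 3)))
      (p : ℝ → (EuclideanSpace ℝ (Fin 3)) → ℝ),
      IsClassicalNSSolutionOn (Ico 0 T) ν 0 u p →
      (∀ T'' < T, HasBoundedSobolevNormsOn (Icc 0 T'') u) →
      SubcriticalLamb u T t₀ ε₀ K c →
      HasSobolevExtensionPast ν u T

/-- plate P1-B «BeltramiCorePowerBound» (M; the content of door B): same prefix, conclusion the
sub-Leray power bound. Print proof = V34 + L34 + Young + G34 with `β = C_η² K⁺/(4ν)`,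
`a = max((2/√3)(1+η)ε₀, (2c − 1)/4, 0) < 1/2` (then `c < a + 1`), see `BeltramiCorePowerBoundAssembly`. -/
def BeltramiCorePowerBound : Prop :=
  ∀ (ν T t₀ ε₀ K c : ℝ), 0 < ν → 0 ≤ t₀ → t₀ < T → 0 < ε₀ → ε₀ < Real.sqrt 3 / 4 → c < 3 / 2 →
    ∀ (u : ℝ → (EuclideanSpace ℝ (Fin 3)) → (EuclideanSpace ℝ (Fin 3)))
      (p : ℝ → (EuclideanSpace ℝ (Fin 3)) → ℝ),
      IsClassicalNSSolutionOn (Ico 0 T) ν 0 u p →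
      (∀ T'' < T, HasBoundedSobolevNormsOn (Icc 0 T'') u) →
      SubcriticalLamb u T t₀ ε₀ K c →
      ∃ K' a : ℝ, 0 ≤ K' ∧ a < 1 / 2 ∧ ∀ t ∈ Ico t₀ T,
        (∫⁻ x, ENNReal.ofReal (frobeniusNormSq (fderiv ℝ (u t) x))) ≤
          ENNReal.ofReal (K' * (T - t) ^ (-a))

/-- composition (kernel-checked): P1-B and S33's P2 give door B. -/
theorem beltramiCoreDoor_of (h₁ : BeltramiCorePowerBound) (h₂ : SubcriticalEnstrophyContinuation) :
    BeltramiCoreDoor := by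
  intro ν T t₀ ε₀ K c hν ht₀ ht₀T hε₀ hε₀' hc u p hsol hreg hlamb
  obtain ⟨K', a, -, ha, hF⟩ := h₁ ν T t₀ ε₀ K c hν ht₀ ht₀T hε₀ hε₀' hc u p hsol hreg hlamb
  exact h₂ ν T t₀ K' a hν ht₀ ht₀T ha u p hsol hreg hF

/-! ## §3 Door S34-C «CriticalMassDoor» -/

/-- support (definition): the CRITICAL MASS hypothesis on `[t₀, T)`: for every `t ∈ [t₀, T)`,
`∫_{S_t} |ω(x,t)|^{3/2} dx ≤ (ε₂ν)^{3/2}` on `S_t = {x : (T − t)|ω(x,t)| > ε₀}`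
(`L^{3/2}` of the vorticity is scale-critical and `ν`-homogeneous: `‖ω(t)‖_{L^{3/2}(S_t)} ≤ ε₂ν`). -/
def CriticalMass (u : ℝ → (EuclideanSpace ℝ (Fin 3)) → (EuclideanSpace ℝ (Fin 3)))
    (ν T t₀ ε₀ ε₂ : ℝ) : Prop :=
  ∀ t ∈ Ico t₀ T,
    (∫⁻ x in {x | ε₀ < (T - t) * ‖curl (u t) x‖},
        ENNReal.ofReal (‖curl (u t) x‖ ^ (3 / 2 : ℝ))) ≤
      ENNReal.ofReal ((ε₂ * ν) ^ (3 / 2 : ℝ))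

/-- door S34-C «CriticalMassDoor» (regularity criterion; type-free; ABSOLUTE constant). There is an
absolute `ε₂ > 0` such that: for `ν > 0`, `0 ≤ t₀ < T`, `0 < ε₀ < √3/4`, in the frame of
`CriticalCoherenceDoor`, `CriticalMass u ν T t₀ ε₀ ε₂` implies that `u` continues in the Sobolev
class past `T`. (`ε₂` does not depend on `ε₀`: door C's engine differentiates no cut-off.) Print
neighbours: `ω` small in `L^∞_t L^{3/2}_x` of a parabolic cylinder ⇒ regular point (Gustafson–Kang–Tsai
2007), on ℝ³ ⇒ Kato's small-`L³` datum via Sobolev; sparseness of vorticity super-level sets at levels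
`λ‖ω‖_∞` (Grujić 2013, Bradshaw–Farhat–Grujić arXiv:1704.05546); here the `L^{3/2}` mass is charged
on the critical super-level set `{(T − t)|ω| > ε₀}` only, type-free. -/
def CriticalMassDoor : Prop :=
  ∃ ε₂ : ℝ, 0 < ε₂ ∧
    ∀ (ν T t₀ ε₀ : ℝ), 0 < ν → 0 ≤ t₀ → t₀ < T → 0 < ε₀ → ε₀ < Real.sqrt 3 / 4 →
    ∀ (u : ℝ → (EuclideanSpace ℝ (Fin 3)) → (EuclideanSpace ℝ (Fin 3)))
      (p : ℝ → (EuclideanSpace ℝ (Fin 3)) → ℝ),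
      IsClassicalNSSolutionOn (Ico 0 T) ν 0 u p →
      (∀ T'' < T, HasBoundedSobolevNormsOn (Icc 0 T'') u) →
      CriticalMass u ν T t₀ ε₀ ε₂ →
      HasSobolevExtensionPast ν u T

/-- plate P1-C «CriticalMassPowerBound» (S/M; the content of door C): same prefix, conclusion the
sub-Leray power bound with `a = (2/√3)ε₀ < 1/2`. Print proof = T34C + G34 (`β = 0`), see
`CriticalMassPowerBoundAssembly`. -/
def CriticalMassPowerBound : Prop :=
  ∃ ε₂ : ℝ, 0 < ε₂ ∧
    ∀ (ν T t₀ ε₀ : ℝ), 0 < ν → 0 ≤ t₀ → t₀ < T → 0 < ε₀ → ε₀ < Real.sqrt 3 / 4 →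
    ∀ (u : ℝ → (EuclideanSpace ℝ (Fin 3)) → (EuclideanSpace ℝ (Fin 3)))
      (p : ℝ → (EuclideanSpace ℝ (Fin 3)) → ℝ),
      IsClassicalNSSolutionOn (Ico 0 T) ν 0 u p →
      (∀ T'' < T, HasBoundedSobolevNormsOn (Icc 0 T'') u) →
      CriticalMass u ν T t₀ ε₀ ε₂ →
      ∃ K a : ℝ, 0 ≤ K ∧ a < 1 / 2 ∧ ∀ t ∈ Ico t₀ T,
        (∫⁻ x, ENNReal.ofReal (frobeniusNormSq (fderiv ℝ (u t) x))) ≤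
          ENNReal.ofReal (K * (T - t) ^ (-a))

/-- composition (kernel-checked): P1-C and S33's P2 give door C. -/
theorem criticalMassDoor_of (h₁ : CriticalMassPowerBound) (h₂ : SubcriticalEnstrophyContinuation) :
    CriticalMassDoor := by
  obtain ⟨ε₂, hε₂, h⟩ := h₁
  refine ⟨ε₂, hε₂, ?_⟩
  intro ν T t₀ ε₀ hν ht₀ ht₀T hε₀ hε₀' u p hsol hreg hmass
  obtain ⟨K, a, -, ha, hF⟩ := h ν T t₀ ε₀ hν ht₀ ht₀T hε₀ hε₀' u p hsol hreg hmass
  exact h₂ ν T t₀ K a hν ht₀ ht₀T ha u p hsol hreg hF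

/-! ## §4 The engine: fixed-time plates V34, L34, T34C and the Grönwall plate G34 -/

/-- plate V34 «ValueCutoffLowStretching» (S; fixed time; shared by doors A and B). For radii
`0 < L < L'` and an admissible field `v` (as in `TwoThresholdStretching`), the stretching weighted by
the value cut-off `radialCutoff L L' (ω x)` (`= 1` where `|ω| ≤ L`, `= 0` where `|ω| ≥ L'`,
values in `[0,1]`) is at most `(2/√3) L' ∫|∇v|²_F`. Proof: pointwise Chae bound
`two_mul_inner_curl_fderiv_le_of_divergence_eq_zero` with `Ω := L'` where the cut-off is non-zero
(`radialCutoff_eq_zero`), `0 ≤ radialCutoff ≤ 1`, `frobeniusNormSq ≥ 0`, monotonicity of the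
integral (the left integrand is integrable: `|ω| < L'` on the support and `∇v ∈ L²`; were it not,
the Bochner integral would be `0 ≤` right side anyway). -/
def ValueCutoffLowStretching : Prop :=
  ∀ (L L' : ℝ), 0 < L → L < L' →
    ∀ ⦃v : (EuclideanSpace ℝ (Fin 3)) → (EuclideanSpace ℝ (Fin 3))⦄ (_ : ContDiff ℝ 2 v)
      (_ : VectorCalculus.IsDivFree v)
      (_ : Integrable fun x => ‖v x‖ ^ 2) (_ : Integrable fun x => ‖fderiv ℝ v x‖ ^ 2)
      (_ : Integrable fun x => ‖fderiv ℝ (fderiv ℝ v) x‖ ^ 2)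
      (_ : ∃ B : ℝ, ∀ x, ‖fderiv ℝ (fderiv ℝ v) x‖ ≤ B),
      2 * ∫ x, radialCutoff L L' (curl v x) * ⟪curl v x, fderiv ℝ v x (curl v x)⟫ ≤
        2 / Real.sqrt 3 * L' * (∫ x, frobeniusNormSq (fderiv ℝ v x))

/-- plate L34 «LambPairingBound» (M; fixed time; the one lemma not in print AS STATED — mechanism =
Farhat 2018 arXiv:1804.08238 §2 (Lamb form, curl onto the cut vorticity, low/high vorticity split) moved
from a fixed level in a ball to an arbitrary level on ℝ³ with a smooth VALUE cut-off; shared by doors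
A and B). For every
`η > 0` there is `C ≥ 0` (depending on `η` only; `C = 2(√2 + B_θ(1+η)/η)` with `B_θ` the gradient
constant of `radialCutoff`, `exists_norm_fderiv_radialCutoff_le_div`) such that for every level
`L > 0` and every admissible field `v`, with `ω = curl v` and the HIGH cut-off
`θ(x) = 1 − radialCutoff L ((1+η)L) (ω x)` (supported in `{|ω| > L}`):
`2∫ θ ⟪ω,(∇v)ω⟫ ≤ C ‖∇ω‖_{L²_F} ‖v × ω‖_{L²({|ω| > L})}`.
Print proof: (i) Lamb–transport identity `(∇v)ω = curl(v × ω) + (∇ω)v` pointwise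
(`curl_cross_apply` with `div v = div ω = 0`, `divergence_curl_eq_zero`); (ii) the transport term
vanishes: `θ(ω)⟪ω,(∇ω)v⟫ = ⟪v, ∇(G ∘ ω)⟫` with `G(w) = ∫₀^{|w|²/2} Θ(√(2r)) dr`
(`Θ(s) = 1 − cutoffProfile` profile of `θ`), `G ∘ ω ∈ C¹_c` (`{|ω| ≥ L}` is compact by
`tendsto_curl_cocompact`), so `∫⟪v,∇(G∘ω)⟫ = −∫(div v)(G∘ω) = 0`; (iii) curl is formally
self-adjoint against the compactly supported `C¹` field `θω` (`div (a × b) = b·curl a − a·curl b`,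
divergence theorem with compact support): `∫⟪θω, curl(v × ω)⟫ = ∫⟪curl(θω), v × ω⟫`;
(iv) `curl(θω) = θ curl ω + ∇θ × ω`, `|curl ω| ≤ √2|∇ω|_F` (`norm_curl_sq_eq_frobeniusNormSq_spin`),
`|∇θ| ≤ (B_θ/(ηL))‖∇ω‖` and `|ω| ≤ (1+η)L` where `∇θ ≠ 0`, so `|∇θ × ω| ≤ (B_θ(1+η)/η)|∇ω|_F`
— the level `L` cancels; (v) Cauchy–Schwarz on `{|ω| > L}`. -/
def LambPairingBound : Prop :=
  ∀ (η : ℝ), 0 < η → ∃ C : ℝ, 0 ≤ C ∧ ∀ (L : ℝ), 0 < L →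
    ∀ ⦃v : (EuclideanSpace ℝ (Fin 3)) → (EuclideanSpace ℝ (Fin 3))⦄ (_ : ContDiff ℝ 2 v)
      (_ : VectorCalculus.IsDivFree v)
      (_ : Integrable fun x => ‖v x‖ ^ 2) (_ : Integrable fun x => ‖fderiv ℝ v x‖ ^ 2)
      (_ : Integrable fun x => ‖fderiv ℝ (fderiv ℝ v) x‖ ^ 2)
      (_ : ∃ B : ℝ, ∀ x, ‖fderiv ℝ (fderiv ℝ v) x‖ ≤ B),
      2 * ∫ x, (1 - radialCutoff L ((1 + η) * L) (curl v x)) *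
          ⟪curl v x, fderiv ℝ v x (curl v x)⟫ ≤
        C * Real.sqrt (∫ x, frobeniusNormSq (fderiv ℝ (curl v) x)) *
          Real.sqrt (∫ x in {x | L < ‖curl v x‖}, ‖cross (v x) (curl v x)‖ ^ 2)

/-- plate T34C «CriticalMassStretching» (S/M; fixed time; door C's whole fixed-time estimate; no
integration by parts). There is an ABSOLUTE `C ≥ 0` such that for every level `L > 0` and every
admissible `C³` field `v` (`C³` so that `lintegral_frobeniusNormSq_fderiv_le_lintegral_sq_norm_curl`
applies to the div-free fields `∂ⱼv`), with `ω = curl v` and `S = {|ω| > L}`: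
`2∫⟪ω,(∇v)ω⟫ ≤ (2/√3) L ∫|∇v|²_F + C (∫_S |ω|^{3/2})^{2/3} ∫|∇ω|²_F`.
Print proof: split `ℝ³ = {|ω| ≤ L} ∪ S`. LOW: pointwise Chae bound with `Ω := L`. HIGH: Hölder with
exponents `(3/2, 6, 6)` on `S`: `2∫_S |ω|²‖∇v‖ ≤ 2‖ω‖_{L^{3/2}(S)} ‖ω‖_{L⁶} ‖∇v‖_{L⁶}`; Sobolev
`eLpNorm_six_le_eLpNorm_fderiv_two` for `ω` and for `∇v` (both `C¹`, in `L²`); finally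
`∫‖∇²v‖² ≤ c ∫|∇ω|²_F` (`lintegral_frobeniusNormSq_fderiv_le_lintegral_sq_norm_curl` for each `∂ⱼv`,
`curl ∂ⱼv = ∂ⱼω`, norm equivalences in finite dimension). -/
def CriticalMassStretching : Prop :=
  ∃ C : ℝ, 0 ≤ C ∧ ∀ (L : ℝ), 0 < L →
    ∀ ⦃v : (EuclideanSpace ℝ (Fin 3)) → (EuclideanSpace ℝ (Fin 3))⦄ (_ : ContDiff ℝ 3 v)
      (_ : VectorCalculus.IsDivFree v)
      (_ : Integrable fun x => ‖v x‖ ^ 2) (_ : Integrable fun x => ‖fderiv ℝ v x‖ ^ 2)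
      (_ : Integrable fun x => ‖fderiv ℝ (fderiv ℝ v) x‖ ^ 2)
      (_ : ∃ B : ℝ, ∀ x, ‖fderiv ℝ (fderiv ℝ v) x‖ ≤ B),
      2 * ∫ x, ⟪curl v x, fderiv ℝ v x (curl v x)⟫ ≤
        2 / Real.sqrt 3 * L * (∫ x, frobeniusNormSq (fderiv ℝ v x)) +
          C * (∫ x in {x | L < ‖curl v x‖}, ‖curl v x‖ ^ (3 / 2 : ℝ)) ^ (2 / 3 : ℝ) *
            (∫ x, frobeniusNormSq (fderiv ℝ (curl v) x))

/-- plate G34 «ForcedPowerGronwallSlab» (S; the Grönwall step with the singular-but-subcritical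
coefficient `a/(T − t)` and a subcritical additive forcing `β(T − t)^{−c}`, `c < a + 1`; shared by
all three doors, `β = 0` for A and C). On a closed slab `[0, T''] × ℝ³`, `T'' < T`, in the frame of
`integral_sq_norm_curl_le_of_direction_slab`: if
`2∫⟪ω,(∇u)ω⟫ ≤ ν∫|∇ω|²_F + (a/(T − t))∫|ω|² + β(T − t)^{−c}` for every `t ∈ [0, T'']`, then
`∫|ω(t)|² ≤ (∫|ω(0)|² · T^a + β T^{a+1−c}/(a+1−c)) (T − t)^{−a}` on `[0, T'']`.
Proof: the enstrophy identity of the slab (as in the tree's slab Grönwall) and the integrating factor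
`(T − t)^a`: `((T − t)^a E)' ≤ β (T − t)^{a−c}`, `∫₀ᵗ (T − s)^{a−c} ds ≤ T^{a+1−c}/(a+1−c)`. -/
def ForcedPowerGronwallSlab : Prop :=
  ∀ (ν T T'' a β c : ℝ), 0 < ν → 0 < T'' → T'' < T → 0 ≤ a → 0 ≤ β → c < a + 1 →
    ∀ (u : ℝ → (EuclideanSpace ℝ (Fin 3)) → (EuclideanSpace ℝ (Fin 3)))
      (p : ℝ → (EuclideanSpace ℝ (Fin 3)) → ℝ),
      IsClassicalNSSolutionOn (Icc 0 T'') ν 0 u p → HasBoundedSobolevNormsOn (Icc 0 T'') u →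
      (∀ t ∈ Icc 0 T'',
        2 * ∫ x, ⟪curl (u t) x, fderiv ℝ (u t) x (curl (u t) x)⟫ ≤
          ν * (∫ x, frobeniusNormSq (fderiv ℝ (curl (u t)) x)) +
            a / (T - t) * (∫ x, ‖curl (u t) x‖ ^ 2) + β * (T - t) ^ (-c)) →
      ∀ t ∈ Icc 0 T'', ∫ x, ‖curl (u t) x‖ ^ 2 ≤
        ((∫ x, ‖curl (u 0) x‖ ^ 2) * T ^ a + β * T ^ (a + 1 - c) / (a + 1 - c)) * (T - t) ^ (-a)

/-! ## §5 Assemblies (glue; no new idea) and the plate compositions -/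

/-- plate A34-A «CriticalCalmPowerBoundAssembly» (M, glue). V34 + L34 + G34 ⇒ P1-A. Given `ε₀`, put
`η := (√3/(4ε₀) − 1)/2 > 0`, `a := (2/√3)(1+η)ε₀ < 1/2`, take `C = C_η` from L34 and the Sobolev
constant `K₆ = SNormLESNormFDerivOfEqConst _ volume 2` (`eLpNorm_six_le_eLpNorm_fderiv_two`), and
`ε₁ := 1/(C K₆ + 1)`. At each `t ∈ [t₀, T)` with `L := ε₀/(T − t)` (so
`{ε₀ < (T − t)|ω|} = {L < |ω|}`): stretching `= V34-part + L34-part ≤ (2/√3)(1+η)L∫|∇u|²_F +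
C‖∇ω‖₂‖u × ω‖_{L²(S_t)}`, `‖u × ω‖_{L²(S_t)} ≤ ‖u‖_{L³(S_t)}‖ω‖_{L⁶} ≤ ε₁ν K₆‖∇ω‖₂`
(`‖a × b‖ ≤ ‖a‖‖b‖`, Hölder `(3,6)` on `S_t`, Sobolev, operator norm `≤` Frobenius norm), hence
`≤ ν∫|∇ω|²_F + (a/(T − t))∫|ω|²` (`∫|∇u|²_F ≤ ∫|ω|²`,
`lintegral_frobeniusNormSq_fderiv_le_lintegral_sq_norm_curl`). Time-translate by `t₀`
(`IsClassicalNSSolutionOn.translate_Ico_zero`), apply G34 with `β = 0` on every slab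
`[0, T'' − t₀]`, `K := (∫|ω(t₀)|²)(T − t₀)^a` independent of `T''`; finally `∫|∇u|²_F ≤ ∫|ω|²`.
Bookkeeping verbatim as in `exists_uniform_H1_bound_of_holderHalf_direction` /
`holderHalf_direction_criterion_of_late`. -/
def CriticalCalmPowerBoundAssembly : Prop :=
  ValueCutoffLowStretching → LambPairingBound → ForcedPowerGronwallSlab → CriticalCalmPowerBound

/-- plate A34-B «BeltramiCorePowerBoundAssembly» (M, glue). V34 + L34 + G34 ⇒ P1-B: as A34-A up to the
HIGH part, where Young `C‖∇ω‖₂‖u × ω‖_{L²(S_t)} ≤ ν‖∇ω‖₂² + (C²/4ν)‖u × ω‖²_{L²(S_t)} ≤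
ν∫|∇ω|²_F + (C²K⁺/4ν)(T − t)^{−c}` (`K⁺ = max K 0`); G34 with `β := C²K⁺/(4ν)` and
`a := max((2/√3)(1+η)ε₀, (2c − 1)/4, 0)` (`a < 1/2` and `c < a + 1` iff `c < 3/2`; the stretching
inequality holds a fortiori with the larger `a`). -/
def BeltramiCorePowerBoundAssembly : Prop :=
  ValueCutoffLowStretching → LambPairingBound → ForcedPowerGronwallSlab → BeltramiCorePowerBound

/-- plate A34-C «CriticalMassPowerBoundAssembly» (S/M, glue). T34C + G34 ⇒ P1-C with the absolute
`ε₂ := 1/(C + 1)`, `C` from T34C: at each `t ∈ [t₀, T)` with `L := ε₀/(T − t)`,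
`C(∫_{S_t}|ω|^{3/2})^{2/3} ≤ Cε₂ν ≤ ν`, so stretching `≤ ν∫|∇ω|²_F + (a/(T − t))∫|ω|²` with
`a = (2/√3)ε₀ < 1/2`; then G34 (`β = 0`) on slabs of the time-translate, as in A34-A. -/
def CriticalMassPowerBoundAssembly : Prop :=
  CriticalMassStretching → ForcedPowerGronwallSlab → CriticalMassPowerBound

/-- composition (kernel-checked): the plates give door A. -/
theorem criticalCalmDoor_of_plates (hV : ValueCutoffLowStretching) (hL : LambPairingBound)
    (hG : ForcedPowerGronwallSlab) (hA : CriticalCalmPowerBoundAssembly)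
    (h₂ : SubcriticalEnstrophyContinuation) : CriticalCalmDoor :=
  criticalCalmDoor_of (hA hV hL hG) h₂

/-- composition (kernel-checked): the plates give door B. -/
theorem beltramiCoreDoor_of_plates (hV : ValueCutoffLowStretching) (hL : LambPairingBound)
    (hG : ForcedPowerGronwallSlab) (hA : BeltramiCorePowerBoundAssembly)
    (h₂ : SubcriticalEnstrophyContinuation) : BeltramiCoreDoor :=
  beltramiCoreDoor_of (hA hV hL hG) h₂

/-- composition (kernel-checked): the plates give door C. -/
theorem criticalMassDoor_of_plates (hT : CriticalMassStretching) (hG : ForcedPowerGronwallSlab)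
    (hA : CriticalMassPowerBoundAssembly) (h₂ : SubcriticalEnstrophyContinuation) :
    CriticalMassDoor :=
  criticalMassDoor_of (hA hT hG) h₂

end Summit.NavierStokesRegularity.NavierStokesRegularity.Theorems.IntenseSetDoors

end
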